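import Summits.QuantumFields.YangMills.Theorems.LangevinControlUVOSLegsFromFemtoAndGapStubLowerTwoPoint

/-!
# Stub `stub_lower` of line `dlr-collar-transfer` (crux `OSLegsFromFemtoAndGap`, stmt-QuantumFields-9367):
# the per-triple signed cumulant floor from FBL + FC2 + FC3

`triple_floor`: at a physical scale `s` chosen inside the growth clauses of FC2/FC3, for every coupling
past the thresholds with `a(β)` small and every torus covering the femto cube, every triple of sites
`x, y, z` read by the three bumps (at `0`, `s v⃗`, `s w⃗`, radius `δs/4`) has
`σ · torusK3(x, y, z) ≥ (c₃ M₃ / (2 s⁸)) a¹²`: FC3's signed conditional floor at the shape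
`n = ⌊s/a⌋`, FC2's two-sided bounds on the three conditional covariances, FBL's boundary law, inside
the cube of radius `R` around `x`, and the law of total cumulance (`k3_triple_lower`).
-/

set_option autoImplicit false

noncomputable section

open scoped SchwartzMap
open MeasureTheory Filter Topology
open Literature.MathematicalPhysics.QuantumFieldTheory Literature.MathematicalPhysics.QuantumLattice
open Literature.MathematicalPhysics.AQFT Literature.Probability.LatticeModels
open Summit.QuantumFields.YangMills.Theorems.OSLegsFromFemtoAndGap.StubLower

namespace Summit.QuantumFields.YangMills.Cruxes.OSLegsFromFemtoAndGap.DlrCollarTransfer.StubLower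

/-! ### Geometry of a triple -/

/-- **Pair geometry, general centres.** If `α u` is within `ρ₀` of `c` and `α u'` within `ρ₀` of
`c'` then `‖α (u' - u) - (c' - c)‖ < 2ρ₀`, hence the physical separation `‖u' - u‖ α` is within
`2ρ₀` of `‖c' - c‖`. [folklore] -/
theorem pair_separation_centres {α ρ₀ : ℝ} (hα : 0 < α) {c c' : EuclideanSpace ℝ (Fin 4)}
    (u u' : Fin 4 → ℤ) (hu : ‖α • siteToE u - c‖ < ρ₀) (hu' : ‖α • siteToE u' - c'‖ < ρ₀) :
    ‖α • siteToE (u' - u) - (c' - c)‖ < 2 * ρ₀ ∧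
      ‖c' - c‖ - 2 * ρ₀ < ‖siteToE (u' - u)‖ * α ∧ ‖siteToE (u' - u)‖ * α < ‖c' - c‖ + 2 * ρ₀ := by
  have key : α • siteToE (u' - u) - (c' - c) = (α • siteToE u' - c') - (α • siteToE u - c) := by
    rw [siteToE_sub, smul_sub]; abel
  have h1 : ‖α • siteToE (u' - u) - (c' - c)‖ < 2 * ρ₀ := by
    rw [key]; exact (norm_sub_le _ _).trans_lt (by linarith)
  have hn : ‖siteToE (u' - u)‖ * α = ‖α • siteToE (u' - u)‖ := by
    rw [norm_smul, Real.norm_eq_abs, abs_of_pos hα, mul_comm]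
  rw [hn]
  refine ⟨h1, ?_, ?_⟩
  · have := norm_sub_norm_le (c' - c) (α • siteToE (u' - u))
    rw [← norm_neg, neg_sub] at h1
    linarith [abs_sub_abs_le_abs_sub ‖c' - c‖ ‖α • siteToE (u' - u)‖,
      abs_norm_sub_norm_le (c' - c) (α • siteToE (u' - u))]
  · have := norm_le_norm_add_norm_sub' (α • siteToE (u' - u)) (c' - c)
    linarith [norm_sub_rev (α • siteToE (u' - u)) (c' - c)]

/-- **FC3's shape at `n = ⌊s/α⌋`** (`n α ≤ s < (n+1) α`). If `‖α (y - x) - s v⃗‖ < δs/2` and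
`α (‖v⃗‖ + δ) ≤ δ s / 2` then `‖(y - x) - n v⃗‖ ≤ δ n`. [folklore] -/
theorem shape_bound {α s δ : ℝ} (hα : 0 < α) (hδ : 0 < δ) {v : EuclideanSpace ℝ (Fin 4)}
    (x y : Fin 4 → ℤ) (h : ‖α • siteToE (y - x) - s • v‖ < δ * s / 2)
    (hαv : α * (‖v‖ + δ) ≤ δ * s / 2) {n : ℕ} (hn1 : (n : ℝ) * α ≤ s) (hn2 : s < (n + 1) * α) :
    ‖siteToE (y - x) - (n : ℝ) • v‖ ≤ δ * n := by
  -- `α ‖u - n v‖ ≤ ‖α u - s v‖ + (s - n α) ‖v‖`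
  have e : α • (siteToE (y - x) - (n : ℝ) • v) = (α • siteToE (y - x) - s • v) + (s - n * α) • v := by
    rw [smul_sub, sub_smul, smul_smul, mul_comm α]; abel
  have h1 : α * ‖siteToE (y - x) - (n : ℝ) • v‖ ≤ δ * s / 2 + α * ‖v‖ := by
    have := norm_add_le (α • siteToE (y - x) - s • v) ((s - n * α) • v)
    rw [← e, norm_smul, norm_smul, Real.norm_eq_abs, Real.norm_eq_abs, abs_of_pos hα,
      abs_of_nonneg (by linarith)] at this
    nlinarith [norm_nonneg v]
  have h2 : δ * s / 2 + α * ‖v‖ ≤ α * (δ * n) := by nlinarith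
  exact le_of_mul_le_mul_left (h1.trans h2) hα

/-! ### Real-arithmetic bookkeeping -/

/-- **Choice of the cube radius (general form).** With `Q = T + D + νb`, `R = ⌈Q/α⌉ + 2`: every site
at lattice distance `ν ≤ νb/α` from the centre has `ν + 2 ≤ R` and depth budget
`(T + D)/α + 3 ≤ R + 1 - ν`; the cube is femto (`(2R+1)α ≤ 2Q + 7α`) and fits (`R + 1 ≤ L`). [folklore] -/
theorem cube_radius_general {α T D νb : ℝ} (hα : 0 < α) (hT : 0 ≤ T) (hD : 0 < D) (hνb : 0 ≤ νb)
    {L : ℕ} (hL : T + D + νb + 4 * α ≤ α * L) :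
    ∃ R : ℕ, 1 ≤ R ∧ R + 1 ≤ L ∧
      (∀ ν : ℝ, ν * α ≤ νb → ν + 2 ≤ R ∧ (T + D) / α + 3 ≤ R + 1 - ν) ∧
      (2 * R + 1) * α ≤ 2 * (T + D + νb) + 7 * α := by
  set Q : ℝ := T + D + νb with hQ
  have hQ0 : 0 ≤ Q := by rw [hQ]; linarith
  obtain ⟨R, hR⟩ : ∃ R : ℕ, R = ⌈Q / α⌉₊ + 2 := ⟨_, rfl⟩
  have hRge : Q / α + 2 ≤ (R : ℝ) := by
    rw [hR]; push_cast; linarith [Nat.le_ceil (Q / α)]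
  have hRle : (R : ℝ) ≤ Q / α + 3 := by
    rw [hR]; push_cast
    linarith [(Nat.ceil_lt_add_one (by positivity : 0 ≤ Q / α)).le]
  refine ⟨R, by rw [hR]; omega, ?_, fun ν hν => ?_, ?_⟩
  · have h1 : Q / α ≤ L - 4 := by rw [div_le_iff₀ hα]; nlinarith
    have : (R : ℝ) + 1 ≤ L := by linarith
    exact_mod_cast this
  · have hν' : ν ≤ νb / α := by rw [le_div_iff₀ hα]; exact hν
    have hsplit : (T + D) / α = Q / α - νb / α := by rw [hQ]; field_simp; ring
    have hνQ : νb / α ≤ Q / α := div_le_div_of_nonneg_right (by rw [hQ]; linarith) hα.le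
    constructor
    · linarith
    · rw [hsplit]; linarith
  · have h1 : (2 * (R : ℝ) + 1) * α ≤ (2 * (Q / α + 3) + 1) * α :=
      mul_le_mul_of_nonneg_right (by linarith) hα.le
    have h2 : (2 * (Q / α + 3) + 1) * α = 2 * Q + 7 * α := by field_simp; ring
    linarith

/-- FC2's two-sided sandwich with `0 < Γ ≤ 1` bounds the conditional covariance `κ` in absolute value
by `C₂⁺ (α/t)⁸` at separations `ν α ≥ t`. [folklore] -/
theorem cov_abs_bound {c₂ C₂ Γv ν κ α t : ℝ} (hc₂ : 0 < c₂) (hΓ : 0 < Γv ∧ Γv ≤ 1) (ht : 0 < t)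
    (hα : 0 < α) (hν : t ≤ ν * α) (hlow : c₂ * Γv ≤ ν ^ 8 * κ) (hup : ν ^ 8 * κ ≤ C₂ * Γv) :
    |κ| ≤ max C₂ 0 * (α / t) ^ 8 := by
  have hν0 : 0 < ν := by
    by_contra h; push Not at h; nlinarith
  have hκ0 : 0 ≤ κ := by
    have : 0 < ν ^ 8 * κ := lt_of_lt_of_le (by nlinarith [hΓ.1]) hlow
    exact (pos_of_mul_pos_right this (by positivity)).le
  rw [abs_of_nonneg hκ0]
  have h1 : ν ^ 8 * κ ≤ max C₂ 0 := hup.trans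
    ((mul_le_mul_of_nonneg_right (le_max_left _ _) hΓ.1.le).trans (by
      nlinarith [le_max_right C₂ 0, hΓ.2]))
  have h2 : κ ≤ max C₂ 0 / ν ^ 8 := by rw [le_div_iff₀ (by positivity)]; linarith
  refine h2.trans ?_
  rw [div_eq_mul_inv, ← inv_pow]
  refine mul_le_mul_of_nonneg_left (pow_le_pow_left₀ (inv_nonneg.2 hν0.le) ?_ 8) (le_max_right _ _)
  rw [inv_le_comm₀ hν0 (by positivity), inv_div, div_le_iff₀ hα]
  exact hν

/-- FC3's signed floor at the shape `n` (`n α ≤ s`, `Γ₃(nα) > M₃ (nα)⁴`) gives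
`σ κ₃ ≥ (c₃ M₃ / s⁸) α¹²`. [folklore] -/
theorem k3_floor_of_shape {c₃ M₃ n α s Γv κ : ℝ} (hc₃ : 0 < c₃) (hM₃ : 0 ≤ M₃) (hn : 0 < n)
    (hα : 0 < α) (hns : n * α ≤ s) (hΓ : M₃ < Γv / (n * α) ^ 4) (h : c₃ * Γv ≤ n ^ 12 * κ) :
    c₃ * M₃ / s ^ 8 * α ^ 12 ≤ κ := by
  have hs : 0 < s := by nlinarith
  rw [lt_div_iff₀ (by positivity)] at hΓ
  have h1 : n ^ 12 * (c₃ * M₃ * α ^ 4 / n ^ 8) ≤ n ^ 12 * κ := by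
    calc n ^ 12 * (c₃ * M₃ * α ^ 4 / n ^ 8) = c₃ * (M₃ * (n * α) ^ 4) := by
          field_simp
      _ ≤ c₃ * Γv := mul_le_mul_of_nonneg_left hΓ.le hc₃.le
      _ ≤ _ := h
  have h2 : c₃ * M₃ * α ^ 4 / n ^ 8 ≤ κ := le_of_mul_le_mul_left h1 (by positivity)
  refine le_trans ?_ h2
  rw [div_mul_eq_mul_div, div_le_div_iff₀ (by positivity) (by positivity)]
  have : (n * α) ^ 8 ≤ s ^ 8 := pow_le_pow_left₀ (by positivity) hns 8
  have key : c₃ * M₃ * α ^ 4 * (n * α) ^ 8 ≤ c₃ * M₃ * α ^ 4 * s ^ 8 :=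
    mul_le_mul_of_nonneg_left this (by positivity)
  calc c₃ * M₃ * α ^ 12 * n ^ 8 = c₃ * M₃ * α ^ 4 * (n * α) ^ 8 := by ring
    _ ≤ _ := key

/-- Signal minus boundary for the third cumulant. [folklore] -/
theorem half_signal3 {c₃ M₃ C₁ C₂p D Vmin s α k : ℝ} (hD : 0 < D) (hα : 0 < α) (hs : 0 < s)
    (hVmin : 0 < Vmin)
    (hM₃C : 6 * C₁ * C₂p / (D ^ 4 * (s * Vmin) ^ 8) + 8 * C₁ ^ 3 / D ^ 12 ≤ c₃ * M₃ / (2 * s ^ 8))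
    (hk : c₃ * M₃ / s ^ 8 * α ^ 12 - 6 * (C₁ * (α / D) ^ 4) * (C₂p * (α / (s * Vmin)) ^ 8)
      - 8 * (C₁ * (α / D) ^ 4) ^ 3 ≤ k) :
    c₃ * M₃ / (2 * s ^ 8) * α ^ 12 ≤ k := by
  have hD0 : D ≠ 0 := hD.ne'
  have hs0 : s ≠ 0 := hs.ne'
  have hV0 : Vmin ≠ 0 := hVmin.ne'
  have e : 6 * (C₁ * (α / D) ^ 4) * (C₂p * (α / (s * Vmin)) ^ 8) + 8 * (C₁ * (α / D) ^ 4) ^ 3 =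
      (6 * C₁ * C₂p / (D ^ 4 * (s * Vmin) ^ 8) + 8 * C₁ ^ 3 / D ^ 12) * α ^ 12 := by
    field_simp
  have : (6 * C₁ * C₂p / (D ^ 4 * (s * Vmin) ^ 8) + 8 * C₁ ^ 3 / D ^ 12) * α ^ 12 ≤
      c₃ * M₃ / (2 * s ^ 8) * α ^ 12 := mul_le_mul_of_nonneg_right hM₃C (by positivity)
  have e2 : c₃ * M₃ / s ^ 8 * α ^ 12 = 2 * (c₃ * M₃ / (2 * s ^ 8) * α ^ 12) := by
    field_simp
  linarith

section TripleFloor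

variable (G : Type) [Group G] [TopologicalSpace G] [IsTopologicalGroup G] [CompactSpace G]
  [MeasurableSpace G] [BorelSpace G] (r : LatticeRep G) (a : ℝ → ℝ)

/-- **The per-triple signed cumulant floor.** See the module docstring. [folklore] -/
theorem triple_floor
    {C₁ β₁ ℓ₁ : ℝ} {p : ℝ → ℝ} (hC₁ : 0 ≤ C₁)
    (hFBL : ∀ β : ℝ, β₁ ≤ β → ∀ (c : Fin 4 → ℤ) (b : ℕ), (b : ℝ) * a β ≤ ℓ₁ →
      ∀ (η : LGConfig 4 G) (x : Fin 4 → ℤ), 2 ≤ depth c b x →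
        |kerE G r β c b η (dens G r x) - p β| ≤ C₁ / (depth c b x : ℝ) ^ 4)
    {Γ : ℝ → ℝ} {β₂ ℓ₂ c₂ C₂ : ℝ} {K : ℝ → ℝ} {n₀ : ℕ} (hc₂ : 0 < c₂) (hK1 : ∀ s, 1 ≤ K s)
    (hΓ1 : ∀ t : ℝ, 0 < t → t ≤ ℓ₂ → 0 < Γ t ∧ Γ t ≤ 1)
    (hFC2 : ∀ β : ℝ, β₂ ≤ β → ∀ (c : Fin 4 → ℤ) (b : ℕ), (b : ℝ) * a β ≤ ℓ₂ →
      ∀ (η : LGConfig 4 G) (x y : Fin 4 → ℤ) (s₀ : ℝ), 0 < s₀ → s₀ ≤ ‖siteToE (y - x)‖ * a β →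
        (n₀ : ℝ) ≤ ‖siteToE (y - x)‖ → K s₀ * ‖siteToE (y - x)‖ ≤ depth c b x →
          K s₀ * ‖siteToE (y - x)‖ ≤ depth c b y →
            c₂ * Γ (‖siteToE (y - x)‖ * a β) ≤
                ‖siteToE (y - x)‖ ^ 8 * kerCov G r β c b η (dens G r x) (dens G r y) ∧
              ‖siteToE (y - x)‖ ^ 8 * kerCov G r β c b η (dens G r x) (dens G r y) ≤
                C₂ * Γ (‖siteToE (y - x)‖ * a β))
    {v w : EuclideanSpace ℝ (Fin 4)} {σ δ : ℝ} {Γ₃ : ℝ → ℝ} {β₃ ℓ₃ c₃ : ℝ} {K₃ : ℝ → ℝ} {n₃ : ℕ}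
    (hσ : σ = 1 ∨ σ = -1) (hδ : 0 < δ) (hc₃ : 0 < c₃) (hK₃1 : ∀ s, 1 ≤ K₃ s)
    (hFC3 : ∀ β : ℝ, β₃ ≤ β → ∀ (c : Fin 4 → ℤ) (b : ℕ), (b : ℝ) * a β ≤ ℓ₃ →
      ∀ (η : LGConfig 4 G) (n : ℕ) (x y z : Fin 4 → ℤ) (s₀ : ℝ), 0 < s₀ → s₀ ≤ (n : ℝ) * a β →
        n₃ ≤ n → ‖siteToE (y - x) - (n : ℝ) • v‖ ≤ δ * n → ‖siteToE (z - x) - (n : ℝ) • w‖ ≤ δ * n →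
          K₃ s₀ * n ≤ depth c b x → K₃ s₀ * n ≤ depth c b y → K₃ s₀ * n ≤ depth c b z →
            c₃ * Γ₃ ((n : ℝ) * a β) ≤ σ * (n : ℝ) ^ 12 * kerK3 G r β c b η x y z)
    {s D M₃ δ₃ Vmin Vmax : ℝ} (hs : 0 < s) (hD : 0 < D) (hM₃ : 0 ≤ M₃) (hVmin : 0 < Vmin)
    (hVv : Vmin ≤ ‖v‖ - δ / 2) (hVw : Vmin ≤ ‖w‖ - δ / 2) (hVvw : Vmin ≤ ‖w - v‖ - δ / 2)
    (hVv' : ‖v‖ + δ / 2 ≤ Vmax) (hVw' : ‖w‖ + δ / 2 ≤ Vmax) (hVvw' : ‖w - v‖ + δ / 2 ≤ Vmax)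
    (hΓ₃M : ∀ t : ℝ, 0 < t → t < δ₃ → M₃ < Γ₃ t / t ^ 4) (hsδ₃ : s < δ₃) (hsℓ₂ : s * Vmax ≤ ℓ₂)
    (hM₃C : 6 * C₁ * max C₂ 0 / (D ^ 4 * (s * Vmin) ^ 8) + 8 * C₁ ^ 3 / D ^ 12 ≤
      c₃ * M₃ / (2 * s ^ 8))
    {β : ℝ} (hβ₁ : β₁ ≤ β) (hβ₂ : β₂ ≤ β) (hβ₃ : β₃ ≤ β) (hα : 0 < a β)
    (hαn₀ : (n₀ : ℝ) * a β ≤ s * Vmin) (hαn₃ : ((n₃ : ℝ) + 1) * a β ≤ s) (hα2 : a β ≤ s / 2)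
    (hαv : a β * (‖v‖ + δ) ≤ δ * s / 2) (hαw : a β * (‖w‖ + δ) ≤ δ * s / 2)
    (hfem₁ : 2 * (K (s * Vmin) * (s * Vmax) + K₃ (s / 2) * s + D + s * Vmax) + 7 * a β ≤ ℓ₁)
    (hfem₂ : 2 * (K (s * Vmin) * (s * Vmax) + K₃ (s / 2) * s + D + s * Vmax) + 7 * a β ≤ ℓ₂)
    (hfem₃ : 2 * (K (s * Vmin) * (s * Vmax) + K₃ (s / 2) * s + D + s * Vmax) + 7 * a β ≤ ℓ₃)
    {L : ℕ} (hL : K (s * Vmin) * (s * Vmax) + K₃ (s / 2) * s + D + s * Vmax + 4 * a β ≤ a β * L)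
    (x y z : Fin 4 → ℤ) (hx : ‖a β • siteToE x‖ < δ * s / 4)
    (hy : ‖a β • siteToE y - s • v‖ < δ * s / 4) (hz : ‖a β • siteToE z - s • w‖ < δ * s / 4) :
    c₃ * M₃ / (2 * s ^ 8) * a β ^ 12 ≤ σ * torusK3 G r β L x y z := by
  have hx' : ‖a β • siteToE x - 0‖ < δ * s / 4 := by rwa [sub_zero]
  have hK0 : 0 ≤ K (s * Vmin) := by linarith only [hK1 (s * Vmin)]
  have hK₃0 : 0 ≤ K₃ (s / 2) := by linarith only [hK₃1 (s / 2)]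
  have hVmax : 0 ≤ Vmax := by linarith only [norm_nonneg v, hVv', hδ]
  have hsV : 0 < s * Vmin := mul_pos hs hVmin
  -- separations of the three pairs
  have nv : ‖s • v - (0 : EuclideanSpace ℝ (Fin 4))‖ = s * ‖v‖ := by
    rw [sub_zero, norm_smul, Real.norm_eq_abs, abs_of_pos hs]
  have nw : ‖s • w - (0 : EuclideanSpace ℝ (Fin 4))‖ = s * ‖w‖ := by
    rw [sub_zero, norm_smul, Real.norm_eq_abs, abs_of_pos hs]
  have nwv : ‖s • w - s • v‖ = s * ‖w - v‖ := by
    rw [← smul_sub, norm_smul, Real.norm_eq_abs, abs_of_pos hs]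
  obtain ⟨hxy0, hxy1, hxy2⟩ := pair_separation_centres hα x y hx' hy
  obtain ⟨hxz0, hxz1, hxz2⟩ := pair_separation_centres hα x z hx' hz
  obtain ⟨-, hyz1, hyz2⟩ := pair_separation_centres hα y z hy hz
  rw [nv] at hxy1 hxy2
  rw [nw] at hxz1 hxz2
  rw [nwv] at hyz1 hyz2
  rw [sub_zero] at hxy0 hxz0
  have hv1 := mul_le_mul_of_nonneg_left hVv hs.le
  have hv2 := mul_le_mul_of_nonneg_left hVv' hs.le
  have hw1 := mul_le_mul_of_nonneg_left hVw hs.le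
  have hw2 := mul_le_mul_of_nonneg_left hVw' hs.le
  have hvw1 := mul_le_mul_of_nonneg_left hVvw hs.le
  have hvw2 := mul_le_mul_of_nonneg_left hVvw' hs.le
  have hsxy : s * Vmin < ‖siteToE (y - x)‖ * a β ∧ ‖siteToE (y - x)‖ * a β < s * Vmax :=
    ⟨by linarith only [hv1, hxy1], by linarith only [hv2, hxy2]⟩
  have hsxz : s * Vmin < ‖siteToE (z - x)‖ * a β ∧ ‖siteToE (z - x)‖ * a β < s * Vmax :=
    ⟨by linarith only [hw1, hxz1], by linarith only [hw2, hxz2]⟩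
  have hsyz : s * Vmin < ‖siteToE (z - y)‖ * a β ∧ ‖siteToE (z - y)‖ * a β < s * Vmax :=
    ⟨by linarith only [hvw1, hyz1], by linarith only [hvw2, hyz2]⟩
  have hshy' : ‖a β • siteToE (y - x) - s • v‖ < δ * s / 2 := by linarith only [hxy0]
  have hshz' : ‖a β • siteToE (z - x) - s • w‖ < δ * s / 2 := by linarith only [hxz0]
  -- FC3's shape `n = ⌊s/α⌋`
  obtain ⟨n, hn1, hn2⟩ : ∃ n : ℕ, (n : ℝ) * a β ≤ s ∧ s < (n + 1) * a β := by
    refine ⟨⌊s / a β⌋₊, ?_, ?_⟩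
    · rw [← le_div_iff₀ hα]; exact Nat.floor_le (by positivity)
    · rw [← div_lt_iff₀ hα]; exact Nat.lt_floor_add_one _
  have hnα : 0 < (n : ℝ) * a β := by linarith only [hn2, hα2, hs]
  have hn0 : 0 < (n : ℝ) := pos_of_mul_pos_left hnα hα.le
  have hn₃n : n₃ ≤ n := by
    have : (n₃ : ℝ) < n := by
      have : (n₃ : ℝ) * a β < n * a β := by linarith only [hαn₃, hn2]
      exact lt_of_mul_lt_mul_right this hα.le
    exact_mod_cast this.le
  have hs₀ : s / 2 ≤ n * a β := by linarith only [hn2, hα2]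
  have hnδ₃ : (n : ℝ) * a β < δ₃ := hn1.trans_lt hsδ₃
  have hns : (n : ℝ) ≤ s / a β := by rw [le_div_iff₀ hα]; exact hn1
  have hshy : ‖siteToE (y - x) - (n : ℝ) • v‖ ≤ δ * n := shape_bound hα hδ x y hshy' hαv hn1 hn2
  have hshz : ‖siteToE (z - x) - (n : ℝ) • w‖ ≤ δ * n := shape_bound hα hδ x z hshz' hαw hn1 hn2
  -- the depth budget `Dep = (T + D)/α + 3`, `T = K(s Vmin) s Vmax + K₃(s/2) s`
  have hKK : 0 ≤ K (s * Vmin) * (s * Vmax) := mul_nonneg hK0 (mul_nonneg hs.le hVmax)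
  have hKK₃ : 0 ≤ K₃ (s / 2) * s := mul_nonneg hK₃0 hs.le
  have hT0 : 0 ≤ K (s * Vmin) * (s * Vmax) + K₃ (s / 2) * s := add_nonneg hKK hKK₃
  obtain ⟨Dep, hDep⟩ : ∃ Dep : ℝ, Dep = (K (s * Vmin) * (s * Vmax) + K₃ (s / 2) * s + D) / a β + 3 :=
    ⟨_, rfl⟩
  have hP : 0 ≤ (K (s * Vmin) * (s * Vmax) + K₃ (s / 2) * s + D) / a β :=
    div_nonneg (by linarith only [hT0, hD]) hα.le
  have hDep2 : (2 : ℝ) ≤ Dep := by rw [hDep]; linarith only [hP]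
  have hDep0 : 0 < Dep := by linarith only [hDep2]
  have hKdep : K (s * Vmin) * (s * Vmax / a β) ≤ Dep := by
    rw [hDep, ← mul_div_assoc]
    have : K (s * Vmin) * (s * Vmax) / a β ≤ (K (s * Vmin) * (s * Vmax) + K₃ (s / 2) * s + D) / a β :=
      div_le_div_of_nonneg_right (by linarith only [hKK₃, hD]) hα.le
    linarith only [this]
  have hK₃dep : K₃ (s / 2) * (s / a β) ≤ Dep := by
    rw [hDep, ← mul_div_assoc]
    have : K₃ (s / 2) * s / a β ≤ (K (s * Vmin) * (s * Vmax) + K₃ (s / 2) * s + D) / a β :=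
      div_le_div_of_nonneg_right (by linarith only [hKK, hD]) hα.le
    linarith only [this]
  have hDa : D / a β ≤ Dep := by
    have : D / a β ≤ (K (s * Vmin) * (s * Vmax) + K₃ (s / 2) * s + D) / a β :=
      div_le_div_of_nonneg_right (by linarith only [hT0]) hα.le
    rw [hDep]; linarith only [this]
  have hK₃ν : K₃ (s / 2) * n ≤ Dep := (mul_le_mul_of_nonneg_left hns hK₃0).trans hK₃dep
  have hKν : ∀ {t : ℝ}, t * a β < s * Vmax → K (s * Vmin) * t ≤ Dep := fun {t} ht => by
    have : t ≤ s * Vmax / a β := by rw [le_div_iff₀ hα]; exact ht.le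
    exact (mul_le_mul_of_nonneg_left this hK0).trans hKdep
  -- the cube of radius `R` around `x`
  obtain ⟨R, hR1, hRL, hRν, hfem⟩ := cube_radius_general (T := K (s * Vmin) * (s * Vmax) + K₃ (s / 2) * s)
    (νb := s * Vmax) hα hT0 hD (by positivity) hL
  obtain ⟨hνyR, hDy⟩ := hRν ‖siteToE (y - x)‖ hsxy.2.le
  obtain ⟨hνzR, hDz⟩ := hRν ‖siteToE (z - x)‖ hsxz.2.le
  obtain ⟨-, hDx⟩ := hRν 0 (by rw [zero_mul]; positivity)
  rw [← hDep] at hDx hDy hDz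
  have hyx : ∀ j, |y j - x j| + 1 ≤ (R : ℤ) := fun j => by
    have h1 := abs_sub_le_norm_siteToE x y j
    have h3 : ((|y j - x j| + 1 : ℤ) : ℝ) ≤ R := by push_cast; linarith only [h1, hνyR]
    exact_mod_cast h3
  have hzx : ∀ j, |z j - x j| + 1 ≤ (R : ℤ) := fun j => by
    have h1 := abs_sub_le_norm_siteToE x z j
    have h3 : ((|z j - x j| + 1 : ℤ) : ℝ) ≤ R := by push_cast; linarith only [h1, hνzR]
    exact_mod_cast h3
  -- the cube is femto
  have hb : ((2 * R + 1 : ℕ) : ℝ) * a β ≤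
      2 * (K (s * Vmin) * (s * Vmax) + K₃ (s / 2) * s + D + s * Vmax) + 7 * a β := by
    push_cast; exact hfem
  have hb₁ := hb.trans hfem₁
  have hb₂ := hb.trans hfem₂
  have hb₃ := hb.trans hfem₃
  -- depths of the three sites (no linear arithmetic on big contexts past this point)
  have hdx0 := le_depth_cube x x R (t := 0) (fun j => by simp)
  have hdx : Dep ≤ (depth (fun j => x j - R) (2 * R + 1) x : ℝ) := hDx.trans hdx0
  have hdy : Dep ≤ (depth (fun j => x j - R) (2 * R + 1) y : ℝ) :=
    hDy.trans (le_depth_cube x y R fun j => abs_sub_le_norm_siteToE x y j)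
  have hdz : Dep ≤ (depth (fun j => x j - R) (2 * R + 1) z : ℝ) :=
    hDz.trans (le_depth_cube x z R fun j => abs_sub_le_norm_siteToE x z j)
  -- FC2: the three conditional covariances are small
  have hcov : ∀ u u' : Fin 4 → ℤ, s * Vmin < ‖siteToE (u' - u)‖ * a β →
      ‖siteToE (u' - u)‖ * a β < s * Vmax →
      Dep ≤ (depth (fun j => x j - R) (2 * R + 1) u : ℝ) →
      Dep ≤ (depth (fun j => x j - R) (2 * R + 1) u' : ℝ) →
      ∀ η, |kerCov G r β (fun j => x j - R) (2 * R + 1) η (dens G r u) (dens G r u')| ≤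
        max C₂ 0 * (a β / (s * Vmin)) ^ 8 := by
    intro u u' h1 h2 hu hu' η
    have hn₀ν : (n₀ : ℝ) ≤ ‖siteToE (u' - u)‖ := le_of_mul_le_mul_right (hαn₀.trans h1.le) hα
    obtain ⟨hlow, hup⟩ := hFC2 β hβ₂ (fun j => x j - R) (2 * R + 1) hb₂ η u u'
      (s * Vmin) hsV h1.le hn₀ν ((hKν h2).trans hu) ((hKν h2).trans hu')
    exact cov_abs_bound hc₂ (hΓ1 _ (hsV.trans h1) (h2.le.trans hsℓ₂)) hsV hα h1.le hlow hup
  -- FC3: the signed floor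
  have hfl : ∀ η, c₃ * M₃ / s ^ 8 * a β ^ 12 ≤
      σ * kerK3 G r β (fun j => x j - R) (2 * R + 1) η x y z := fun η => by
    have h := hFC3 β hβ₃ (fun j => x j - R) (2 * R + 1) hb₃ η n x y z (s / 2)
      (half_pos hs) hs₀ hn₃n hshy hshz (hK₃ν.trans hdx) (hK₃ν.trans hdy) (hK₃ν.trans hdz)
    have h' : c₃ * Γ₃ (n * a β) ≤
        (n : ℝ) ^ 12 * (σ * kerK3 G r β (fun j => x j - R) (2 * R + 1) η x y z) := by
      calc c₃ * Γ₃ (n * a β)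
          ≤ σ * (n : ℝ) ^ 12 * kerK3 G r β (fun j => x j - R) (2 * R + 1) η x y z := h
        _ = _ := by ring
    exact k3_floor_of_shape hc₃ hM₃ hn0 hα hn1 (hΓ₃M _ hnα hnδ₃) h'
  -- FBL: the boundary law at depth `≥ D/α`
  have hh : ∀ u : Fin 4 → ℤ, Dep ≤ (depth (fun j => x j - R) (2 * R + 1) u : ℝ) →
      ∀ η, |kerE G r β (fun j => x j - R) (2 * R + 1) η (dens G r u) - p β| ≤
        C₁ * (a β / D) ^ 4 := by
    intro u hu η
    have h2u : 2 ≤ depth (fun j => x j - R) (2 * R + 1) u := by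
      have : (2 : ℝ) ≤ depth (fun j => x j - R) (2 * R + 1) u := hDep2.trans hu
      exact_mod_cast this
    exact boundary_of_depth hC₁ hD hα (hDep0.trans_le hu) (hDa.trans hu)
      (hFBL β hβ₁ _ _ hb₁ η u h2u)
  -- law of total cumulance
  exact half_signal3 hD hα hs hVmin hM₃C
    (k3_triple_lower G r β x y z R L hRL hR1 hyx hzx hσ (hh x hdx) (hh y hdy) (hh z hdz)
      (hcov y z hsyz.1 hsyz.2 hdy hdz) (hcov x z hsxz.1 hsxz.2 hdx hdz)
      (hcov x y hsxy.1 hsxy.2 hdx hdy) hfl)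

end TripleFloor

end Summit.QuantumFields.YangMills.Cruxes.OSLegsFromFemtoAndGap.DlrCollarTransfer.StubLower

end
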